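import Literature.AnabelianGeometry.SemiGraphs.EdgeAlignedStabilizers
import Literature.AnabelianGeometry.SemiGraphs.PullbackFunctor

/-!
# The global base point read at an EDGE basepoint is the transport of the one read at a vertex
# ([SemiAnbd] Def. 2.2 (i) p. 23, Rem. 2.2.1 p. 24, Rem. 2.4.2 p. 26)

Mochizuki, *Semi-graphs of anabelioids*, Publ. RIMS **42** (2006) 221–322, §2: Def. 2.2 (i) p. 23, Rem. 2.2.1
p. 24 ("the image of each `Π_v` [resp. `Π_b`] … is equal to the stabilizer …"), Rem. 2.4.2 p. 26 (the
2-cells `φ_{b′}`) [cite: MochizukiSemiAnbd2006, Rem. 2.2.1 p.24].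

PROOF-ONLY companion (abc-iut cell, layer L3; FACT-LIST row F-1478 / (J1), brick **(T-α)** of abc-iut-f-161's
route memo `HOME/staging/f/f-161/J1-TIE-ROUTE.md`; seat abc-iut-w4-d079).  For a covering `ψ : ℋ → 𝒦` with a
GLOBAL witness (`αψ`, `e_ψ`), the (D1) global base point (`range_pi1Map_eq_stabilizer′`,
`DecompositionGroupGeneral`) can be read at the basepoint of `B(𝒦)` through a VERTEX `u` (point
`a₀ ∈ F(A_u)`) or through an EDGE `f` (point `a₀^E ∈ F_f(A_f)`).  Along a branch `b′ ↦ b` of `e′ ↦ f` abutting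
to `w ↦ u`, with the induced basepoints `F := ψ_w^* ⋙ F′`, `F_f := ψ_{e′}^* ⋙ F_{e′}` and a frame
`α′ : b′^* ⋙ F_{e′} ≅ F′`:

* `Hom.globalBasePoint_edge_eq_transport` — **`a₀^E = F_f(ψ_b)(alignIso⁻¹ a₀)`**, the transported point
  of abc-iut-f-161's `EdgeAlignedStabilizers` (`IsBranchAligned.edge_stabilizer_eq_of_global`): the
  morphism `αψ(η_{𝟙_A}) ≫ e_ψ⁻¹_A` of `B(ℋ)` commutes with the gluings (`BObj.Hom.comm`), the gluing of
  `ψ^*A` along `b′` is `ψ_{b′}`-then-`ψ_{e′}^*(ψ_b)`-then-re-indexing (`Hom.gluingIso`), and the fibre of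
  `F_{e′}` at `(αψ 𝟙_A)_{e′}` is one point.

With `EdgeSectionBasePoint` (`map_sectionMapE_basePoint_std`: the edge section map sends the local edge base
point to `a₀^E`) this feeds `IsBranchAligned.edge_mono_of_map_eq`: the edge section map is a
monomorphism.  No `def`, no new `Prop`; nothing here takes a side on [IUTchIII] Cor. 3.12.
-/

namespace Literature.AnabelianGeometry.SemiGraphs

namespace SemiGraphOfAnabelioids

namespace Hom

open CategoryTheory CategoryTheory.Limits CategoryTheory.PreGaloisCategory
open Literature.AnabelianGeometry.Anabelioids

universe v₁ u₁ u

variable {ℋ 𝒦 : SemiGraphOfAnabelioids.{v₁, u₁, u}}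

/-- Re-indexing there and back: `reindex(e, g, g′).hom_A = reindex(e, g′, g).inv_A`.
[cite: MochizukiSemiAnbd2006, Rem. 2.4.2 p.26] -/
theorem reindexIso_hom_app_eq_inv_app (ψ : Hom ℋ 𝒦) (e' : ℋ.graph.Edge) (g g' : 𝒦.graph.Edge)
    (p : ψ.base.edgeMap e' = g) (p' : ψ.base.edgeMap e' = g') (A : 𝒦.BObj) :
    (ψ.reindexIso e' g g' p p').hom.app A = (ψ.reindexIso e' g' g p' p).inv.app A := by
  subst p; subst p'
  rfl

set_option backward.isDefEq.respectTransparency false in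
/-- **(T-α) The global base point through an edge is the transport of the one through a vertex.**
Let `ψ : ℋ → 𝒦`, `A ∈ B(𝒦)` with a global witness `αψ : B(𝒦)_{/A} ⥤ B(ℋ)`, `e_ψ : ψ^* ≅ (A × −) ⋙ αψ`; a
branch `b′` of `ℋ` abutting to `w`, over `b` (abutting to `u = ψ w`); basepoints `F′` of `ℋ_w`, `F_{e′}` of
`ℋ_{e′}` (`e′` the edge of `b′`) with a frame `α′ : b′^* ⋙ F_{e′} ≅ F′`; one-point fibres `t_V ∈ F′((αψ 𝟙_A)_w)`,
`t_E ∈ F_{e′}((αψ 𝟙_A)_{e′})`.  Then the (D1) base point for the EDGE basepoint `ρ_{e′} ⋙ F_{e′}` (identification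
`reindex ▷ F_{e′}`, re-indexed to the edge `f` of `b`) equals `F_f(ψ_b)(alignIso⁻¹ a₀)` for the (D1) base point
`a₀` of the VERTEX basepoint `ρ_w ⋙ F′` (identity identification) — the transported point of
`IsBranchAligned.edge_stabilizer_eq_of_global`. [cite: MochizukiSemiAnbd2006, Rem. 2.2.1 p.24] -/
theorem globalBasePoint_edge_eq_transport (ψ : Hom ℋ 𝒦) (A : 𝒦.BObj) [HasBinaryProducts 𝒦.BObj]
    (αψ : Over A ⥤ ℋ.BObj) (eψ : ψ.pullbackFunctor ≅ Over.star A ⋙ αψ)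
    (w : ℋ.graph.Vertex) (F' : ℋ.V w ⥤ FintypeCat.{v₁})
    (b' : ℋ.graph.Branch) (h' : ℋ.graph.abuts b' = some w) (b : 𝒦.graph.Branch)
    (p : ψ.base.branchMap b' = b) (Fe' : ℋ.E (ℋ.graph.edgeOf b') ⥤ FintypeCat.{v₁})
    (α' : (ℋ.pull b' w h').pullback ⋙ Fe' ≅ F')
    [Subsingleton (Fe'.obj ((αψ.obj (Over.mk (𝟙 A))).T (ℋ.graph.edgeOf b')))]
    (tV : (ℋ.ρ w ⋙ F').obj (αψ.obj (Over.mk (𝟙 A))))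
    (tE : (ℋ.ρE (ℋ.graph.edgeOf b') ⋙ Fe').obj (αψ.obj (Over.mk (𝟙 A)))) :
    (show ((ψ.φE (ℋ.graph.edgeOf b') (𝒦.graph.edgeOf b) (ψ.edgeMap_edgeOf_of_branchMap b' b p)).pullback
        ⋙ Fe').obj (A.T (𝒦.graph.edgeOf b)) from
      (Functor.isoWhiskerRight (ψ.reindexIso (ℋ.graph.edgeOf b') (ψ.base.edgeMap (ℋ.graph.edgeOf b'))
          (𝒦.graph.edgeOf b) rfl (ψ.edgeMap_edgeOf_of_branchMap b' b p)) Fe' ≪≫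
        Functor.isoWhiskerLeft (𝒦.ρE (𝒦.graph.edgeOf b))
          (Iso.refl ((ψ.φE (ℋ.graph.edgeOf b') (𝒦.graph.edgeOf b)
            (ψ.edgeMap_edgeOf_of_branchMap b' b p)).pullback ⋙ Fe'))).hom.app A
        ((ℋ.ρE (ℋ.graph.edgeOf b') ⋙ Fe').map
          (αψ.map ((Over.forgetAdjStar A).unit.app (Over.mk (𝟙 A))) ≫ eψ.inv.app A) tE)) =
    ((ψ.φE (ℋ.graph.edgeOf b') (𝒦.graph.edgeOf b) (ψ.edgeMap_edgeOf_of_branchMap b' b p)).pullback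
        ⋙ Fe').map (A.ψ b (ψ.base.vertexMap w) (p ▸ ψ.base.abuts_branchMap b' w h')).hom
      ((ψ.alignIso b' w h' b p F' Fe' α').inv.app (A.S (ψ.base.vertexMap w))
        (show ((ψ.φV w).pullback ⋙ F').obj (A.S (ψ.base.vertexMap w)) from
          (Functor.isoWhiskerLeft (𝒦.ρ (ψ.base.vertexMap w))
              (Iso.refl ((ψ.φV w).pullback ⋙ F'))).hom.app A
            ((ℋ.ρ w ⋙ F').map
              (αψ.map ((Over.forgetAdjStar A).unit.app (Over.mk (𝟙 A))) ≫ eψ.inv.app A) tV))) := by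
  subst p
  -- notation: `g := αψ(η_{𝟙_A}) ≫ e_ψ⁻¹_A : αψ 𝟙_A ⟶ ψ^* A`
  set g := αψ.map ((Over.forgetAdjStar A).unit.app (Over.mk (𝟙 A))) ≫ eψ.inv.app A with hg
  -- the left-hand side, unfolded: `F_{e′}(reindex_A)(F_{e′}(g_{e′})(t_E))`
  change (Fe'.map ((ψ.reindexIso (ℋ.graph.edgeOf b') (ψ.base.edgeMap (ℋ.graph.edgeOf b'))
      (𝒦.graph.edgeOf (ψ.base.branchMap b')) rfl (ψ.edgeMap_edgeOf_of_branchMap b' _ rfl)).hom.app A) ≫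
        𝟙 _) (Fe'.map (g.fT (ℋ.graph.edgeOf b')) tE) = _
  rw [Category.comp_id]
  -- the right-hand side, unfolded: `F_{e′}(b′^*(g_w) ≫ φB ≫ ψ_{e′}^*(ψ_b))(α′⁻¹ t_V)`
  have hR : ((ψ.φE (ℋ.graph.edgeOf b') (𝒦.graph.edgeOf (ψ.base.branchMap b'))
        (ψ.edgeMap_edgeOf_of_branchMap b' _ rfl)).pullback ⋙ Fe').map
        (A.ψ (ψ.base.branchMap b') (ψ.base.vertexMap w) (ψ.base.abuts_branchMap b' w h')).hom
      ((ψ.alignIso b' w h' _ rfl F' Fe' α').inv.app (A.S (ψ.base.vertexMap w))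
        (show ((ψ.φV w).pullback ⋙ F').obj (A.S (ψ.base.vertexMap w)) from
          (Functor.isoWhiskerLeft (𝒦.ρ (ψ.base.vertexMap w))
              (Iso.refl ((ψ.φV w).pullback ⋙ F'))).hom.app A ((ℋ.ρ w ⋙ F').map g tV))) =
      Fe'.map ((ℋ.pull b' w h').pullback.map (g.fS w) ≫ (ψ.φB b' w h').hom.app (A.S (ψ.base.vertexMap w)) ≫
        (ψ.φE (ℋ.graph.edgeOf b') (𝒦.graph.edgeOf (ψ.base.branchMap b'))
          (ψ.edgeMap_edgeOf_of_branchMap b' _ rfl)).pullback.map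
          (A.ψ (ψ.base.branchMap b') (ψ.base.vertexMap w) (ψ.base.abuts_branchMap b' w h')).hom)
        (α'.inv.app ((ℋ.ρ w).obj (αψ.obj (Over.mk (𝟙 A)))) tV) := by
    -- `alignIso⁻¹_X = α′⁻¹_{ψ_w^* X} ≫ F_{e′}(φB_X)` and naturality of `α′⁻¹`
    have hnat := FunctorToFintypeCat.naturality F' ((ℋ.pull b' w h').pullback ⋙ Fe') α'.inv (g.fS w) tV
    change Fe'.map _ ((α'.inv.app _ ≫ Fe'.map ((ψ.φB b' w h').hom.app (A.S (ψ.base.vertexMap w))))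
      (F'.map (g.fS w) tV)) = _
    rw [FintypeCat.comp_apply]
    erw [hnat]
    simp only [Functor.comp_map, CategoryTheory.Functor.map_comp, FintypeCat.comp_apply]
    rfl
  -- `b′^*(g_w) ≫ φB ≫ ψ_{e′}^*(ψ_b) = (αψ 𝟙_A).ψ_{b′} ≫ g_{e′} ≫ reindex⁻¹`
  -- (`(ψ^*A).ψ_{b′} = φB ≫ ψ_{e′}^*(ψ_b) ≫ reindex`, `Hom.gluingIso`; `BObj.Hom.comm` for `g`)
  have hM : (ℋ.pull b' w h').pullback.map (g.fS w) ≫ (ψ.φB b' w h').hom.app (A.S (ψ.base.vertexMap w)) ≫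
        (ψ.φE (ℋ.graph.edgeOf b') (𝒦.graph.edgeOf (ψ.base.branchMap b'))
          (ψ.edgeMap_edgeOf_of_branchMap b' _ rfl)).pullback.map
          (A.ψ (ψ.base.branchMap b') (ψ.base.vertexMap w) (ψ.base.abuts_branchMap b' w h')).hom =
      ((αψ.obj (Over.mk (𝟙 A))).ψ b' w h').hom ≫ g.fT (ℋ.graph.edgeOf b') ≫
        (ψ.reindexIso (ℋ.graph.edgeOf b') _ _ (ψ.base.edgeOf_branchMap b').symm rfl).inv.app A := by
    have hψ : (ψ.φB b' w h').hom.app (A.S (ψ.base.vertexMap w)) ≫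
        (ψ.φE (ℋ.graph.edgeOf b') (𝒦.graph.edgeOf (ψ.base.branchMap b'))
          (ψ.edgeMap_edgeOf_of_branchMap b' _ rfl)).pullback.map
          (A.ψ (ψ.base.branchMap b') (ψ.base.vertexMap w) (ψ.base.abuts_branchMap b' w h')).hom =
        ((ψ.pullbackFunctor.obj A).ψ b' w h').hom ≫
          (ψ.reindexIso (ℋ.graph.edgeOf b') _ _ (ψ.base.edgeOf_branchMap b').symm rfl).inv.app A := by
      have hglue : (ψ.pullbackFunctor.obj A).ψ b' w h' = (ψ.gluingIso b' w h').app A := rfl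
      rw [hglue, Iso.app_hom, Hom.gluingIso, Iso.trans_hom, Iso.trans_hom, NatTrans.comp_app,
        NatTrans.comp_app, Category.assoc, Category.assoc, Iso.hom_inv_id_app, Category.comp_id,
        Functor.isoWhiskerLeft_hom, Functor.whiskerLeft_app, Functor.isoWhiskerRight_hom,
        Functor.whiskerRight_app]
      rfl
    rw [hψ, ← Category.assoc, g.comm b' w h', Category.assoc]
    rfl
  -- the point `F_{e′}((αψ 𝟙_A).ψ_{b′})(α′⁻¹ t_V)` of the one-point fibre is `t_E`
  have hpt : (Fe'.map ((αψ.obj (Over.mk (𝟙 A))).ψ b' w h').hom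
      (α'.inv.app ((ℋ.ρ w).obj (αψ.obj (Over.mk (𝟙 A)))) tV) :
        Fe'.obj ((αψ.obj (Over.mk (𝟙 A))).T (ℋ.graph.edgeOf b'))) = tE :=
    Subsingleton.elim _ _
  rw [hR, hM, CategoryTheory.Functor.map_comp, FintypeCat.comp_apply, CategoryTheory.Functor.map_comp,
    FintypeCat.comp_apply]
  exact (congrArg (fun x => Fe'.map ((ψ.reindexIso (ℋ.graph.edgeOf b') _ _
      (ψ.base.edgeOf_branchMap b').symm rfl).inv.app A) (Fe'.map (g.fT (ℋ.graph.edgeOf b')) x))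
    hpt).symm

end Hom

end SemiGraphOfAnabelioids

end Literature.AnabelianGeometry.SemiGraphs
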